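import Summits.ABC.IUTFork.Cor312SettingMSharp
import Summits.ABC.IUTFork.Cor312PilotIdelesPrInvariance
import Summits.ABC.IUTFork.Cor312PilotIdelesM
import Literature.IUT.LogVolume.TensorPacketSlotUnion
import HarnessLib

/-!
# [IUTchIII] Cor. 3.12 — the M-LEVEL sharp settings `settingMSharp` (frames route) and `settingPrVolSharpM` (summand route)
# are CANONICAL: they read the Θ- and q-ideles only through their absolute values (M-twin of `Cor312PilotIdelesPrInvariance`)

PROOF-ONLY record file (D-0012; 0 definitions, 0 `Prop` facts) of the abc-iut cell, seat abc-iut-C-cert-2 (branch C certificate seat;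
rung LADDER-ABC:A2.C): the M-level twin of this seat's `Cor312PilotIdelesPrInvariance` (p438766, for abc-iut-c312-7's `settingPrVolSharp`).
abc-iut-w5-d166's M-level setting `Real.settingMSharp D hlog … t tq htq0 Sq htq1` over the genuine carriers `K_{v̲}`, `v̲ ∈ V̲` — the setting of
the G1-Θ certificates `Conditional.abc_of_SH_v7M` (abc-iut-C-cert-3, p439027) and of the P3–P7 Θ-side chain — reads its Θ-ideles `t` and
q-ideles `tq` ONLY THROUGH THEIR ABSOLUTE VALUES: the sharp box `ι_j(t)·(R_I)^∼` is unit-invariant (`sharpBoxM_eq_of_norm_eq`, via abc-iut-S1's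
`iota_smul_normalizedPacket_eq_of_norm_eq_one`), the q-hull-set reads only `‖λ_q‖ = ‖t_q‖` (`hullSet_qCentreM_eq_of_norm_eq`, `norm_qCentreM`),
and abc-iut-c312-6's assembly `FrameVolumePieces.settingOfFrameVolumes = Setting.ofFrames` consumes the q-centre only through that hull-set
(`settingOfFrameVolumes_eq_of_hullSet_eq`). Hence `settingMSharp_eq_of_norm_eq` (a literal equality of `Cor312.Setting`s, so of `Licence`,
`PilotKummerCompatHull`, `thetaHull`, `thetaLocal`, `negLogTheta`, `negLogQ`, `Statement`) and `settingMSharp_eq_of_log_norm_eq` (any two idele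
families satisfying the SAME closed form for `log ‖·‖` — e.g. abc-iut-w5-d033's realisation shape of `tThetaM`/`tqM`, or two genuine volume
inputs of the same initial Θ-datum and section, cf. abc-iut-w5-d156 `GenuineLogThetaIdeleInvariance` — give THE SAME setting): the idele slot
of the datum adds nothing to the M-line's hypotheses `hSH`/`hΘ`/`hA` — they are statements about the initial Θ-datum and `V̲` alone, as in
print (`𝒪_𝕃(−D) := a·𝒪_𝕃` for ANY `a` with `div a = D`, Dupuy–Hilado §3.9; `q̲_v` ANY `2l`-th root, [IUTchI] Ex. 3.2 (iv)).

HONEST FRAMING: bookkeeping about OUR typed objects; nothing here bears on `−|log(Θ)|` versus `−|log(q)|`, on [IUTchIII] Cor. 3.12 or on abc,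
and no side is taken on any author; typed ≠ proved; instantiated ≠ endorsed. [cite: DupuyHilado2025, §3.7, §3.9]
[cite: Mochizuki2012, IUTchI Ex. 3.2 (iv) p. 71; IUTchIV Prop. 1.4 (i) p. 13, Thm. 1.10 Step (v) p. 27] [claim: Mochizuki2012, status: disputed]
-/

noncomputable section

open Set Function NumberField IsDedekindDomain
open scoped Pointwise

namespace Summit.ABC.IUTFork.Thm311.Real

open Cor312 Cor312Vol Literature.IUT.LogThetaLattice Literature.IUT.LogVolume Literature.IUT.HodgeTheaters

variable {F K Fbar : Type} [Field F] [NumberField F] [Field K] [NumberField K] [Algebra F K]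
  [Field Fbar] [Algebra F Fbar] [Algebra K Fbar] {E : WeierstrassCurve F} [E.IsElliptic] {l : ℕ}
  {Pb : BadPlacePredicates K} (D : InitialThetaData F K Fbar E l Pb) {logvK : PadicLogsVal K}
  (hlog : LogvAnalyticVal logvK)
  (t t' : ∀ (u : FinitePlace ℚ) (_ : Fin (thetaIndexOfInitial D).lstar) (x : (thetaIndexOfInitial D).Fibre (Val.non u)),
    kOfM D (ratChar u) u (natCast_ratChar_mem u) x)
  (tq tq' : ∀ (u : FinitePlace ℚ) (x : (thetaIndexOfInitial D).Fibre (Val.non u)),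
    kOfM D (ratChar u) u (natCast_ratChar_mem u) x)

/-! ## §1. The M-level Θ-boxes and q-hull-sets read only the absolute values of the ideles -/

/-- Equal absolute values of the Θ-ideles give equal absolute values of the label ideles. [cite: DupuyHilado2025, §3.9] -/
theorem norm_labelIdeleM_eq_of_norm_eq (h : ∀ u i x, ‖t u i x‖ = ‖t' u i x‖) (u : FinitePlace ℚ) (j : (thetaIndexOfInitial D).Label)
    (x : (thetaIndexOfInitial D).Fibre (Val.non u)) : ‖labelIdeleM D t u j x‖ = ‖labelIdeleM D t' u j x‖ := by
  unfold labelIdeleM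
  split_ifs
  · exact h _ _ _
  · rfl

/-- **The M-level sharp Θ-boxes `ι_j(t_{Θ,j,v̲_j})·(R_I)^∼` depend on the Θ-ideles only through their absolute values.**
[cite: DupuyHilado2025, §3.7, §3.9] [cite: Mochizuki2012, IUTchIV Thm. 1.10 Step (v) p. 27] -/
theorem sharpBoxM_eq_of_norm_eq (ht0 : ∀ u i x, t u i x ≠ 0) (h : ∀ u i x, ‖t u i x‖ = ‖t' u i x‖) :
    sharpBoxM D hlog t = sharpBoxM D hlog t' := by
  funext u j e
  have ha : labelIdeleM D t u j (e (Fin.last _)) ≠ 0 := labelIdeleM_ne_zero D t ht0 u j _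
  have hn := norm_labelIdeleM_eq_of_norm_eq D t t' h u j (e (Fin.last _))
  have hna : ‖labelIdeleM D t u j (e (Fin.last _))‖ ≠ 0 := norm_ne_zero_iff.mpr ha
  have hu : ‖(labelIdeleM D t u j (e (Fin.last _)))⁻¹ * labelIdeleM D t' u j (e (Fin.last _))‖ = 1 := by
    rw [norm_mul, norm_inv, ← hn, inv_mul_cancel₀ hna]
  have hdec : labelIdeleM D t' u j (e (Fin.last _)) =
      labelIdeleM D t u j (e (Fin.last _)) * ((labelIdeleM D t u j (e (Fin.last _)))⁻¹ * labelIdeleM D t' u j (e (Fin.last _))) := by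
    rw [mul_inv_cancel_left₀ ha]
  have hmul : iota (ratChar u) ((presAtM D hlog u).kk e) (Fin.last _) (labelIdeleM D t' u j (e (Fin.last _))) =
      iota (ratChar u) ((presAtM D hlog u).kk e) (Fin.last _) (labelIdeleM D t u j (e (Fin.last _))) *
        iota (ratChar u) ((presAtM D hlog u).kk e) (Fin.last _)
          ((labelIdeleM D t u j (e (Fin.last _)))⁻¹ * labelIdeleM D t' u j (e (Fin.last _))) := by
    conv_lhs => rw [hdec]
    exact map_mul _ _ _
  have key : iota (ratChar u) ((presAtM D hlog u).kk e) (Fin.last _) (labelIdeleM D t' u j (e (Fin.last _))) •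
        (normalizedPacket (ratChar u) ((presAtM D hlog u).kk e) : Set (PacketAlgebra (ratChar u) ((presAtM D hlog u).kk e))) =
      iota (ratChar u) ((presAtM D hlog u).kk e) (Fin.last _) (labelIdeleM D t u j (e (Fin.last _))) •
        (normalizedPacket (ratChar u) ((presAtM D hlog u).kk e) : Set (PacketAlgebra (ratChar u) ((presAtM D hlog u).kk e))) := by
    rw [hmul, ← smul_smul, iota_smul_normalizedPacket_eq_of_norm_eq_one (ratChar u) ((presAtM D hlog u).kk e) (Fin.last _) hu]
  unfold sharpBoxM
  exact key.symm

/-- **The M-level Θ-box families agree** for Θ-ideles with the same absolute values. [cite: DupuyHilado2025, §3.9, §4.10] -/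
theorem thetaBoxM_eq_of_norm_eq (ht0 : ∀ u i x, t u i x ≠ 0) (h : ∀ u i x, ‖t u i x‖ = ‖t' u i x‖) :
    thetaBoxM D hlog t = thetaBoxM D hlog t' := by
  funext j vQ
  cases vQ with
  | inl w => rfl
  | inr u =>
    show (presAtM D hlog u).boxOf (sharpBoxM D hlog t u j) = (presAtM D hlog u).boxOf (sharpBoxM D hlog t' u j)
    rw [sharpBoxM_eq_of_norm_eq D hlog t t' ht0 h]

/-- **The M-level q-hull-sets `λ_q·𝒪_L` depend on the q-ideles only through their absolute values.**
[cite: DupuyHilado2025, §3.9] [cite: Mochizuki2012, IUTchIV Prop. 1.4 (i) p. 13] -/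
theorem hullSet_qCentreM_eq_of_norm_eq (h : ∀ u x, ‖tq u x‖ = ‖tq' u x‖) :
    ∀ (j : (thetaIndexOfInitial D).Label) (vQ : (thetaIndexOfInitial D).VQ),
      hullSet (factorFieldM D hlog j vQ) (qCentreM D hlog tq j vQ) = hullSet (factorFieldM D hlog j vQ) (qCentreM D hlog tq' j vQ)
  | _, .inl _ => by
    unfold hullSet
    exact congrArg (polydisc _) (funext fun s => s.elim)
  | j, .inr u => by
    unfold hullSet
    refine congrArg (polydisc _) (funext fun s => ?_)
    exact (norm_qCentreM D hlog tq j u s).trans ((h u _).trans (norm_qCentreM D hlog tq' j u s).symm)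

/-! ## §2. The assembled M-level sharp setting is a function of the absolute values of the ideles -/

section Setting

variable (M : Type) [Field M] [NumberField M]
  (archPk : ∀ (j : (thetaIndexOfInitial D).Label) (vQ : (thetaIndexOfInitial D).VQ),
    Set ((logShellsOfInitialDH D logvK).Packet j vQ))
  (archSub : ∀ (j : (thetaIndexOfInitial D).Label) (v : (thetaIndexOfInitial D).V),
    Set ((logShellsOfInitialDH D logvK).Packet j ((thetaIndexOfInitial D).over v)))
  (Ψ : ℤ → ∀ v : (thetaIndexOfInitial D).V, v ∈ (thetaIndexOfInitial D).Vbad →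
    Set ((logShellsOfInitialDH D logvK).StarPacket v))
  (act : ℤ → ∀ v : (thetaIndexOfInitial D).V, v ∈ (thetaIndexOfInitial D).Vbad →
    (logShellsOfInitialDH D logvK).StarPacket v → Module.End ℚ ((logShellsOfInitialDH D logvK).StarPacket v))
  (Mmod : ℤ → ∀ j : (thetaIndexOfInitial D).LabelStar, Set ((logShellsOfInitialDH D logvK).GlobalPacket j.1))
  (region : ℤ → ∀ j : (thetaIndexOfInitial D).LabelStar, FinDivisor M → ∀ vQ : (thetaIndexOfInitial D).VQ,
    Set ((logShellsOfInitialDH D logvK).Packet j.1 vQ))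
  (n : ℤ) {HT : Type} {LogLink : HT → HT → Type} {IsFull : ∀ {s t : HT}, LogLink s t → Prop}
  (lat : LGPGaussianLogThetaLattice LogLink IsFull)
  {Frd : Type} {IsoF : Frd → Frd → Type} {Ob : Frd → Type} {realify : Frd → Frd} {Strip : Type}
  {IsoS : Strip → Strip → Type} {Mv : ∀ v : (thetaIndexOfInitial D).V, v ∈ (thetaIndexOfInitial D).Vbad → Type}
  [∀ v h, Monoid (Mv v h)]
  (sig : GlobalLGPFrobenioidSignature (thetaIndexOfInitial D).lstar (thetaIndexOfInitial D).V
    (· ∈ (thetaIndexOfInitial D).Vbad) Frd IsoF Ob realify Strip IsoS Mv)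
  (split : SplittingMonoids Mv) {ObΔ : Type} {N : ∀ v : (thetaIndexOfInitial D).V, v ∈ (thetaIndexOfInitial D).Vbad → Type}
  [∀ v h, Monoid (N v h)] (qData : QPilotData ObΔ N)

/-- **abc-iut-c312-6's assembly over the M-level field-box pieces reads the q-centre only through its hull-set**: equal Θ-box binders
and q-centres with the SAME hull-sets give the SAME `settingOfFrameVolumes` (literal equality; the proof fields are propositions).
[cite: DupuyHilado2025, §3.9] -/
theorem settingOfFrameVolumes_M_eq_of_hullSet_eq
    {thetaBox : ℤ → Ob sig.Clgp → ∀ (j : (thetaIndexOfInitial D).Label) (vQ : (thetaIndexOfInitial D).VQ),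
      Set (∀ s : factorIdxM D hlog j vQ, factorFieldM D hlog j vQ s)}
    {qCentre qCentre' : ObΔ → ∀ (j : (thetaIndexOfInitial D).Label) (vQ : (thetaIndexOfInitial D).VQ),
      ∀ s : factorIdxM D hlog j vQ, factorFieldM D hlog j vQ s}
    {hq : ∀ j vQ s, qCentre (qPilotObject qData) j vQ s ≠ 0} {hq' : ∀ j vQ s, qCentre' (qPilotObject qData) j vQ s ≠ 0}
    {hfin : ∀ j : (thetaIndexOfInitial D).Label, (Function.support fun vQ =>
      ((situationMFrames D hlog M archPk archSub Ψ act Mmod region).D n).logvol j vQ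
        ((frameVolumePiecesOfInitialDH D hlog).e j vQ ⁻¹'
          hullSet ((frameVolumePiecesOfInitialDH D hlog).K j vQ) (qCentre (qPilotObject qData) j vQ))).Finite}
    {hfin' : ∀ j : (thetaIndexOfInitial D).Label, (Function.support fun vQ =>
      ((situationMFrames D hlog M archPk archSub Ψ act Mmod region).D n).logvol j vQ
        ((frameVolumePiecesOfInitialDH D hlog).e j vQ ⁻¹'
          hullSet ((frameVolumePiecesOfInitialDH D hlog).K j vQ) (qCentre' (qPilotObject qData) j vQ))).Finite}
    (hqc : ∀ o j vQ, hullSet (factorFieldM D hlog j vQ) (qCentre o j vQ) = hullSet (factorFieldM D hlog j vQ) (qCentre' o j vQ)) :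
    FrameVolumePieces.settingOfFrameVolumes (S := situationMFrames D hlog M archPk archSub Ψ act Mmod region)
        (V := frameVolumePiecesOfInitialDH D hlog) (n := n) lat sig split qData thetaBox qCentre hq hfin
        (realizes_situationMFrames D hlog M archPk archSub Ψ act Mmod region n) =
      FrameVolumePieces.settingOfFrameVolumes (S := situationMFrames D hlog M archPk archSub Ψ act Mmod region)
        (V := frameVolumePiecesOfInitialDH D hlog) (n := n) lat sig split qData thetaBox qCentre' hq' hfin'
        (realizes_situationMFrames D hlog M archPk archSub Ψ act Mmod region n) := by
  have hfun : (fun (o : ObΔ) (j : (thetaIndexOfInitial D).Label) (vQ : (thetaIndexOfInitial D).VQ) =>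
        (frameVolumePiecesOfInitialDH D hlog).e j vQ ⁻¹' hullSet ((frameVolumePiecesOfInitialDH D hlog).K j vQ) (qCentre o j vQ)) =
      fun o j vQ => (frameVolumePiecesOfInitialDH D hlog).e j vQ ⁻¹' hullSet ((frameVolumePiecesOfInitialDH D hlog).K j vQ)
        (qCentre' o j vQ) := by
    funext o j vQ
    exact congrArg _ (hqc o j vQ)
  unfold FrameVolumePieces.settingOfFrameVolumes Setting.ofFrames
  congr 1

/-- **THE M-LEVEL SHARP SETTING IS A FUNCTION OF THE ABSOLUTE VALUES OF THE IDELES**: equal `‖t_{Θ,i,x}‖` and `‖t_{q,x}‖` everywhere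
give EQUAL settings `settingMSharp` (whatever the finite sets `Sq`, `Sq'` off which the q-ideles are units) — hence equal `Licence`,
`PilotKummerCompatHull`, `thetaHull`, `thetaLocal`, `negLogTheta`, `negLogQ`, `Statement`. [cite: DupuyHilado2025, §3.7, §3.9]
[cite: Mochizuki2012, IUTchIV Prop. 1.4 (i) p. 13, Thm. 1.10 Step (v) p. 27] -/
theorem settingMSharp_eq_of_norm_eq (ht0 : ∀ u i x, t u i x ≠ 0) (htq0 : ∀ u x, tq u x ≠ 0) (htq0' : ∀ u x, tq' u x ≠ 0)
    (Sq Sq' : Finset (FinitePlace ℚ))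
    (htq1 : ∀ (u : FinitePlace ℚ) (x : (thetaIndexOfInitial D).Fibre (Val.non u)), u ∉ Sq → ‖tq u x‖ = 1)
    (htq1' : ∀ (u : FinitePlace ℚ) (x : (thetaIndexOfInitial D).Fibre (Val.non u)), u ∉ Sq' → ‖tq' u x‖ = 1)
    (ht : ∀ u i x, ‖t u i x‖ = ‖t' u i x‖) (htq : ∀ u x, ‖tq u x‖ = ‖tq' u x‖) :
    settingMSharp D hlog M archPk archSub Ψ act Mmod region n lat sig split qData t tq htq0 Sq htq1 =
      settingMSharp D hlog M archPk archSub Ψ act Mmod region n lat sig split qData t' tq' htq0' Sq' htq1' := by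
  unfold settingMSharp
  rw [thetaBoxM_eq_of_norm_eq D hlog t t' ht0 ht]
  exact settingOfFrameVolumes_M_eq_of_hullSet_eq D hlog M archPk archSub Ψ act Mmod region n lat sig split qData
    (fun _ j vQ => hullSet_qCentreM_eq_of_norm_eq D hlog tq tq' htq j vQ)

/-- **ANY TWO IDELE FAMILIES WITH THE SAME CLOSED FORM FOR `log ‖·‖` GIVE THE SAME M-LEVEL SHARP SETTING** (e.g. two realisations of
`P_Θ`, `P_q` in Dupuy–Hilado's normalisation, abc-iut-w5-d033's shape for `tThetaM`/`tqM`; or the ideles of two genuine volume inputs of the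
same initial Θ-datum and section): the honestly-scaled M-setting is an invariant of `(D, V̲)` and the context binders.
[cite: DupuyHilado2025, §3.4, §3.9] [cite: Mochizuki2012, IUTchI Ex. 3.2 (iv) p. 71] -/
theorem settingMSharp_eq_of_log_norm_eq (ht0 : ∀ u i x, t u i x ≠ 0) (ht0' : ∀ u i x, t' u i x ≠ 0)
    (htq0 : ∀ u x, tq u x ≠ 0) (htq0' : ∀ u x, tq' u x ≠ 0) (Sq Sq' : Finset (FinitePlace ℚ))
    (htq1 : ∀ (u : FinitePlace ℚ) (x : (thetaIndexOfInitial D).Fibre (Val.non u)), u ∉ Sq → ‖tq u x‖ = 1)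
    (htq1' : ∀ (u : FinitePlace ℚ) (x : (thetaIndexOfInitial D).Fibre (Val.non u)), u ∉ Sq' → ‖tq' u x‖ = 1)
    (RΘ : ∀ (u : FinitePlace ℚ) (_ : Fin (thetaIndexOfInitial D).lstar) (_ : (thetaIndexOfInitial D).Fibre (Val.non u)), ℝ)
    (Rq : ∀ (u : FinitePlace ℚ) (_ : (thetaIndexOfInitial D).Fibre (Val.non u)), ℝ)
    (hT : ∀ u i x, Real.log ‖t u i x‖ = RΘ u i x) (hT' : ∀ u i x, Real.log ‖t' u i x‖ = RΘ u i x)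
    (hQ : ∀ u x, Real.log ‖tq u x‖ = Rq u x) (hQ' : ∀ u x, Real.log ‖tq' u x‖ = Rq u x) :
    settingMSharp D hlog M archPk archSub Ψ act Mmod region n lat sig split qData t tq htq0 Sq htq1 =
      settingMSharp D hlog M archPk archSub Ψ act Mmod region n lat sig split qData t' tq' htq0' Sq' htq1' :=
  settingMSharp_eq_of_norm_eq D hlog t t' tq tq' M archPk archSub Ψ act Mmod region n lat sig split qData ht0 htq0 htq0' Sq Sq' htq1 htq1'
    (fun u i x => norm_eq_of_log_norm_eq (ht0 u i x) (ht0' u i x) ((hT u i x).trans (hT' u i x).symm))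
    (fun u x => norm_eq_of_log_norm_eq (htq0 u x) (htq0' u x) ((hQ u x).trans (hQ' u x).symm))


/-! ## §3 (APPENDIX). The SUMMAND-route M-level sharp setting `settingPrVolSharpM` (abc-iut-s2-p8, p438078 — the setting of the G1-Θ
certificate v8 `Conditional.abc_of_SH_v8M`, abc-iut-C-cert-3) is canonical in the same way -/

/-- **abc-iut-w4-d013's summand-route assembly `settingPrVolM` reads the q-centre only through its hull-set** (M-twin of
`settingPrVol_eq_of_hullSet_eq`). [cite: DupuyHilado2025, §3.9] -/
theorem settingPrVolM_eq_of_hullSet_eq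
    {thetaBox : ℤ → Ob sig.Clgp → ∀ (j : (thetaIndexOfInitial D).Label) (vQ : (thetaIndexOfInitial D).VQ),
      Set (∀ s : factorIdxM D hlog j vQ, factorFieldM D hlog j vQ s)}
    {qCentre qCentre' : ObΔ → ∀ (j : (thetaIndexOfInitial D).Label) (vQ : (thetaIndexOfInitial D).VQ),
      ∀ s : factorIdxM D hlog j vQ, factorFieldM D hlog j vQ s}
    {hq : ∀ j vQ s, qCentre (qPilotObject qData) j vQ s ≠ 0} {hq' : ∀ j vQ s, qCentre' (qPilotObject qData) j vQ s ≠ 0}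
    {hfin : ∀ j : (thetaIndexOfInitial D).Label, (Function.support fun vQ =>
      ((situationPrVolM D hlog M archPk archSub Ψ act Mmod region).D n).logvol j vQ
        (factorMapM D hlog j vQ ⁻¹' hullSet (factorFieldM D hlog j vQ) (qCentre (qPilotObject qData) j vQ))).Finite}
    {hfin' : ∀ j : (thetaIndexOfInitial D).Label, (Function.support fun vQ =>
      ((situationPrVolM D hlog M archPk archSub Ψ act Mmod region).D n).logvol j vQ
        (factorMapM D hlog j vQ ⁻¹' hullSet (factorFieldM D hlog j vQ) (qCentre' (qPilotObject qData) j vQ))).Finite}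
    (hqc : ∀ o j vQ, hullSet (factorFieldM D hlog j vQ) (qCentre o j vQ) = hullSet (factorFieldM D hlog j vQ) (qCentre' o j vQ)) :
    settingPrVolM D hlog M archPk archSub Ψ act Mmod region n lat sig split qData thetaBox qCentre hq hfin =
      settingPrVolM D hlog M archPk archSub Ψ act Mmod region n lat sig split qData thetaBox qCentre' hq' hfin' := by
  have hfun : (fun (o : ObΔ) (j : (thetaIndexOfInitial D).Label) (vQ : (thetaIndexOfInitial D).VQ) =>
        factorMapM D hlog j vQ ⁻¹' hullSet (factorFieldM D hlog j vQ) (qCentre o j vQ)) =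
      fun o j vQ => factorMapM D hlog j vQ ⁻¹' hullSet (factorFieldM D hlog j vQ) (qCentre' o j vQ) := by
    funext o j vQ
    rw [hqc]
  unfold settingPrVolM Setting.ofComparison
  congr 1

/-- **THE SUMMAND-ROUTE M-LEVEL SHARP SETTING IS A FUNCTION OF THE ABSOLUTE VALUES OF THE IDELES** (the setting of abc-iut-C-cert-3's
v8 `Conditional.GenuineMOrbit.cor312Of_of_SH` / `abc_of_SH_v8M`): equal `‖t_{Θ,i,x}‖`, `‖t_{q,x}‖` everywhere ⇒ EQUAL `settingPrVolSharpM`.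
[cite: DupuyHilado2025, §3.7, §3.9] [cite: Mochizuki2012, IUTchIV Prop. 1.4 (i) p. 13, Thm. 1.10 Step (v) p. 27] -/
theorem settingPrVolSharpM_eq_of_norm_eq (ht0 : ∀ u i x, t u i x ≠ 0) (htq0 : ∀ u x, tq u x ≠ 0) (htq0' : ∀ u x, tq' u x ≠ 0)
    (Sq Sq' : Finset (FinitePlace ℚ))
    (htq1 : ∀ (u : FinitePlace ℚ) (x : (thetaIndexOfInitial D).Fibre (Val.non u)), u ∉ Sq → ‖tq u x‖ = 1)
    (htq1' : ∀ (u : FinitePlace ℚ) (x : (thetaIndexOfInitial D).Fibre (Val.non u)), u ∉ Sq' → ‖tq' u x‖ = 1)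
    (ht : ∀ u i x, ‖t u i x‖ = ‖t' u i x‖) (htq : ∀ u x, ‖tq u x‖ = ‖tq' u x‖) :
    settingPrVolSharpM D hlog t tq M archPk archSub Ψ act Mmod region n lat sig split qData htq0 Sq htq1 =
      settingPrVolSharpM D hlog t' tq' M archPk archSub Ψ act Mmod region n lat sig split qData htq0' Sq' htq1' := by
  unfold settingPrVolSharpM
  rw [thetaBoxM_eq_of_norm_eq D hlog t t' ht0 ht]
  exact settingPrVolM_eq_of_hullSet_eq D hlog M archPk archSub Ψ act Mmod region n lat sig split qData
    (fun _ j vQ => hullSet_qCentreM_eq_of_norm_eq D hlog tq tq' htq j vQ)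

/-- **ANY TWO IDELE FAMILIES WITH THE SAME CLOSED FORM FOR `log ‖·‖` GIVE THE SAME SUMMAND-ROUTE M-SETTING** (e.g. abc-iut-w5-d033's
realisation shape; the ideles of two genuine volume inputs of the same initial Θ-datum and section).
[cite: DupuyHilado2025, §3.4, §3.9] [cite: Mochizuki2012, IUTchI Ex. 3.2 (iv) p. 71] -/
theorem settingPrVolSharpM_eq_of_log_norm_eq (ht0 : ∀ u i x, t u i x ≠ 0) (ht0' : ∀ u i x, t' u i x ≠ 0)
    (htq0 : ∀ u x, tq u x ≠ 0) (htq0' : ∀ u x, tq' u x ≠ 0) (Sq Sq' : Finset (FinitePlace ℚ))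
    (htq1 : ∀ (u : FinitePlace ℚ) (x : (thetaIndexOfInitial D).Fibre (Val.non u)), u ∉ Sq → ‖tq u x‖ = 1)
    (htq1' : ∀ (u : FinitePlace ℚ) (x : (thetaIndexOfInitial D).Fibre (Val.non u)), u ∉ Sq' → ‖tq' u x‖ = 1)
    (RΘ : ∀ (u : FinitePlace ℚ) (_ : Fin (thetaIndexOfInitial D).lstar) (_ : (thetaIndexOfInitial D).Fibre (Val.non u)), ℝ)
    (Rq : ∀ (u : FinitePlace ℚ) (_ : (thetaIndexOfInitial D).Fibre (Val.non u)), ℝ)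
    (hT : ∀ u i x, Real.log ‖t u i x‖ = RΘ u i x) (hT' : ∀ u i x, Real.log ‖t' u i x‖ = RΘ u i x)
    (hQ : ∀ u x, Real.log ‖tq u x‖ = Rq u x) (hQ' : ∀ u x, Real.log ‖tq' u x‖ = Rq u x) :
    settingPrVolSharpM D hlog t tq M archPk archSub Ψ act Mmod region n lat sig split qData htq0 Sq htq1 =
      settingPrVolSharpM D hlog t' tq' M archPk archSub Ψ act Mmod region n lat sig split qData htq0' Sq' htq1' :=
  settingPrVolSharpM_eq_of_norm_eq D hlog t t' tq tq' M archPk archSub Ψ act Mmod region n lat sig split qData ht0 htq0 htq0' Sq Sq'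
    htq1 htq1' (fun u i x => norm_eq_of_log_norm_eq (ht0 u i x) (ht0' u i x) ((hT u i x).trans (hT' u i x).symm))
    (fun u x => norm_eq_of_log_norm_eq (htq0 u x) (htq0' u x) ((hQ u x).trans (hQ' u x).symm))

end Setting

end Summit.ABC.IUTFork.Thm311.Real

end
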